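import Summits.HubbardSuperconductivity.HubbardSuperconductivity.Theorems.LevyLogBootstrapLevyTransportCrudeFloorHops
import HarnessLib

/-!
# Crude floor, part 2: the hop chain along walks, row sums, Collatz–Wielandt

Crux `LevyTransport` (stmt-HubbardSuperconductivity-15049, route `LevyLogBootstrap`), input (c) of
the load-bearing stub `stub_logBootstrap` (`Cruxes/LevyTransport/Lines/birth.lean`): the M-UNIFORM
ANCHOR of the Lévy mass at the KLS point `Δ = 0`. The anchor is proved WITHOUT reflection positivity
from long-range order + the `T = 0` infrared bound + a crude Perron–Frobenius floor; this file is one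
link of that chain (files `…LevyTransportCrudeFloorHops`, `…RowSums`, `…Periodic`, `…Variational`,
`…CrudeFloor`, `…AnchorBlocks`, `…AnchorXY`). Model: `H_G(Δ) = xxzHamiltonian 1 G (-1) Δ`
(hard-core bosons; spin ½, label `0` = up = particle), on the torus `G = torusGraph 2 M`.
Sources: H. Tasaki, *Physics and Mathematics of Quantum Many-Body Systems* (2020) §2.4;
E. Lieb, D. Mattis, J. Math. Phys. 3 (1962) 749; T. Kennedy, E. H. Lieb, B. S. Shastry,
Phys. Rev. Lett. 61 (1988) 2582. No definition is introduced; sorry-free.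

This file: one hop costs at most `2λ` along a nonnegative eigenvector
(`re_le_two_mul_lam_mul_re_of_hop`), the shift-register induction along walks
(`re_le_pow_mul_re_of_walk`), the all-ones row sums `H_Heis 𝟙 = (|E|/4)𝟙` (`heis_mulVec_const`,
registered torus form `crudeFloor_heis_rowsum_torus`), diagonal and off-diagonal row budgets, the
Collatz–Wielandt lower bound `eigenvalue_ge_of_nonneg` and the row constant
`re_diag_sub_eigenvalue_le` (`λ = |E(G)|` for `|Δ| ≤ 1`).
-/

noncomputable section

set_option linter.dupNamespace false

namespace Summit.HubbardSuperconductivity.HubbardSuperconductivity.Theorems.LevyLogBootstrap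

open scoped BigOperators Matrix ComplexOrder
open Matrix Finset Complex
open Literature.MathematicalPhysics.QuantumLattice Literature.Probability.LatticeModels
open Literature.MathematicalPhysics.QuantumLattice.LiebMattis
open Summit.AtomisticToContinuum.BoseEinsteinCondensation.Theorems.BECStronglyRayleighSectorPerron
open Summit.HubbardSuperconductivity.HubbardSuperconductivity.Theorems.PolyaSchurPairBoson

namespace CrudeFloor

variable {Λ : Type*} [Fintype Λ] [DecidableEq Λ]

section Ham

variable (G : SimpleGraph Λ) [DecidableRel G.Adj] (Δ : ℝ)

/-- **One hop costs at most a factor `2λ`** along a nonnegative eigenvector: if `H_G(Δ) φ = E φ`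
with `φ ≥ 0` entrywise real and `λ ≥ H_{ττ} - E` for all `τ`, then for an edge `{x,y}` and a
configuration with `σ_x = 0`, `σ_y = 1`: `φ(σ) ≤ 2λ · φ(σ[x↦1][y↦0])` (row `σ[x↦1][y↦0]` of the
eigen-equation: all hop terms are nonnegative, the one coming back from `σ` is `½ φ(σ)`).
Tasaki (2020) §2.4, proof of Thm 2.3 (quantitative form). [folklore] -/
theorem re_le_two_mul_lam_mul_re_of_hop {φ : TensorIndex Λ 2 → ℂ}
    (hnn : ∀ σ, 0 ≤ (φ σ).re ∧ (φ σ).im = 0) {E : ℝ}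
    (hHφ : (xxzHamiltonian 1 G (-1) Δ : Op Λ 2) *ᵥ φ = (E : ℂ) • φ) {lam : ℝ}
    (hlam : ∀ τ : TensorIndex Λ 2, ((xxzHamiltonian 1 G (-1) Δ : Op Λ 2) τ τ).re - E ≤ lam)
    {x y : Λ} (hadj : G.Adj x y) {σ : TensorIndex Λ 2} (hx : σ x = 0) (hy : σ y = 1) :
    (φ σ).re ≤ 2 * lam * (φ (Function.update (Function.update σ x 1) y 0)).re := by
  obtain ⟨happ, hreal, hsymm, hoff⟩ := ham_entries G Δ
  have hheis := half_le_re_heis_of_hop G hadj hx hy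
  set H : Op Λ 2 := xxzHamiltonian 1 G (-1) Δ with hHdef
  set τ : TensorIndex Λ 2 := Function.update (Function.update σ x 1) y 0 with hτ
  have hxy : x ≠ y := hadj.ne
  have hτy : τ y = 0 := by rw [hτ, Function.update_self]
  have hστ : σ ≠ τ := fun h => by
    have := congrFun h y
    rw [hy, hτy] at this
    exact absurd this (by decide)
  have him : ∀ a b, (H a b).im = 0 := fun a b => by
    have h := congrArg Complex.im (hreal a b)
    rw [Complex.star_def, Complex.conj_im] at h
    linarith
  -- row `τ` of the eigen-equation, real parts
  have hrow := congrFun hHφ τ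
  rw [Pi.smul_apply, smul_eq_mul, mulVec, dotProduct] at hrow
  have hre : ∀ ρ, (H τ ρ * φ ρ).re = (H τ ρ).re * (φ ρ).re := fun ρ => by
    rw [Complex.mul_re, him, (hnn ρ).2, mul_zero, sub_zero]
  have hrowre : ∑ ρ, (H τ ρ).re * (φ ρ).re = E * (φ τ).re := by
    have h := congrArg Complex.re hrow
    rw [Complex.re_sum, Complex.re_ofReal_mul] at h
    simp_rw [hre] at h
    exact h
  -- isolate the diagonal term
  rw [← Finset.add_sum_erase _ _ (Finset.mem_univ τ)] at hrowre
  -- every off-diagonal term is `≤ 0`; the one at `σ` is `≤ -½ φ(σ)`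
  have hterms : ∀ ρ ∈ (Finset.univ : Finset (TensorIndex Λ 2)).erase τ,
      (H τ ρ).re * (φ ρ).re ≤ 0 := fun ρ hρ =>
    mul_nonpos_of_nonpos_of_nonneg (hoff τ ρ (Finset.ne_of_mem_erase hρ).symm) (hnn ρ).1
  have hσmem : σ ∈ (Finset.univ : Finset (TensorIndex Λ 2)).erase τ :=
    Finset.mem_erase.2 ⟨hστ, Finset.mem_univ σ⟩
  have hsum_le : ∑ ρ ∈ (Finset.univ : Finset (TensorIndex Λ 2)).erase τ, (H τ ρ).re * (φ ρ).re ≤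
      (H τ σ).re * (φ σ).re := by
    rw [← Finset.add_sum_erase _ _ hσmem]
    have : ∑ ρ ∈ ((Finset.univ : Finset (TensorIndex Λ 2)).erase τ).erase σ, (H τ ρ).re * (φ ρ).re ≤ 0 :=
      Finset.sum_nonpos fun ρ hρ => hterms ρ (Finset.mem_of_mem_erase hρ)
    linarith
  have hτσ : (H τ σ).re ≤ -(1 / 2 : ℝ) := by
    rw [happ τ σ hστ.symm, Complex.neg_re, heisenbergHamiltonian_apply_comm]
    linarith
  have hφσ := (hnn σ).1
  have hφτ := (hnn τ).1
  have h1 : (H τ σ).re * (φ σ).re ≤ -(1 / 2 : ℝ) * (φ σ).re :=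
    mul_le_mul_of_nonneg_right hτσ hφσ
  -- `(H_ττ - E) φ τ = -Σ_{ρ≠τ} H_τρ φ ρ ≥ ½ φ σ`
  have h2 : (1 / 2 : ℝ) * (φ σ).re ≤ ((H τ τ).re - E) * (φ τ).re := by nlinarith
  have h3 : ((H τ τ).re - E) * (φ τ).re ≤ lam * (φ τ).re :=
    mul_le_mul_of_nonneg_right (hlam τ) hφτ
  linarith

/-- **Moving a particle along a walk costs at most `(2λ)^{length}`** (shift-register induction):
under the hypotheses of `re_le_two_mul_lam_mul_re_of_hop` and `2λ ≥ 1`, for a walk of `G` from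
`a` to `b ≠ a` and a configuration with `σ_a = 1`, `σ_b = 0`,
`φ(σ) ≤ (2λ)^{length} φ(σ[a↦0][b↦1])`. If the next vertex of the walk is occupied, first move its
particle to `a` and recurse; if it is empty, first recurse (move the particle at `b` there), then
hop it to `a`. Lieb–Mattis (1962), proof of Thm 2; Tasaki (2020) §2.4. [folklore] -/
theorem re_le_pow_mul_re_of_walk {φ : TensorIndex Λ 2 → ℂ}
    (hnn : ∀ σ, 0 ≤ (φ σ).re ∧ (φ σ).im = 0) {E : ℝ}
    (hHφ : (xxzHamiltonian 1 G (-1) Δ : Op Λ 2) *ᵥ φ = (E : ℂ) • φ) {lam : ℝ}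
    (hlam : ∀ τ : TensorIndex Λ 2, ((xxzHamiltonian 1 G (-1) Δ : Op Λ 2) τ τ).re - E ≤ lam)
    (hlam1 : 1 ≤ 2 * lam) {a b : Λ} (p : G.Walk a b) :
    a ≠ b → ∀ σ : TensorIndex Λ 2, σ a = 1 → σ b = 0 →
      (φ σ).re ≤ (2 * lam) ^ p.length * (φ (Function.update (Function.update σ a 0) b 1)).re := by
  induction p with
  | nil => intro h; exact absurd rfl h
  | @cons u c w hadj p ih =>
    intro hub σ hu hw
    have huc : u ≠ c := hadj.ne
    rw [SimpleGraph.Walk.length_cons]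
    have hpow1 : ∀ n : ℕ, (1 : ℝ) ≤ (2 * lam) ^ n := fun n => one_le_pow₀ hlam1
    have hlam0 : 0 ≤ 2 * lam := by linarith
    by_cases hcw : c = w
    · -- direct hop across the edge `{u, w}`
      subst hcw
      have h := re_le_two_mul_lam_mul_re_of_hop G Δ hnn hHφ hlam hadj.symm hw hu
      rw [Function.update_comm huc.symm] at h
      have hφ := (hnn (Function.update (Function.update σ u 0) c 1)).1
      calc (φ σ).re ≤ 2 * lam * (φ (Function.update (Function.update σ u 0) c 1)).re := h
        _ ≤ (2 * lam) ^ (p.length + 1) * (φ (Function.update (Function.update σ u 0) c 1)).re := by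
            refine mul_le_mul_of_nonneg_right ?_ hφ
            calc 2 * lam = (2 * lam) ^ 1 := (pow_one _).symm
              _ ≤ (2 * lam) ^ (p.length + 1) := pow_le_pow_right₀ (by linarith) (by omega)
    · rcases fin_two_eq_zero_or_one (σ c) with hc | hc
      · -- `c` occupied: hop its particle to `u`, then recurse from `c`
        set σ' : TensorIndex Λ 2 := Function.update (Function.update σ c 1) u 0 with hσ'
        have h1 := re_le_two_mul_lam_mul_re_of_hop G Δ hnn hHφ hlam hadj.symm hc hu
        rw [← hσ'] at h1
        have hσ'c : σ' c = 1 := by rw [hσ', Function.update_of_ne huc.symm, Function.update_self]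
        have hσ'w : σ' w = 0 := by
          rw [hσ', Function.update_of_ne (Ne.symm hub), Function.update_of_ne (Ne.symm hcw)]
          · exact hw
        have h2 := ih hcw σ' hσ'c hσ'w
        have heq : Function.update (Function.update σ' c 0) w 1 =
            Function.update (Function.update σ u 0) w 1 := by
          have e1 : Function.update (Function.update σ c 1) u 0 =
              Function.update (Function.update σ u 0) c 1 := Function.update_comm huc.symm _ _ _
          have e2 : (Function.update σ u 0) c = 0 := by
            rw [Function.update_of_ne huc.symm]; exact hc
          rw [hσ', e1, Function.update_idem, update_eq_of_apply_eq e2]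
        rw [heq] at h2
        have hφ := (hnn (Function.update (Function.update σ u 0) w 1)).1
        calc (φ σ).re ≤ 2 * lam * (φ σ').re := h1
          _ ≤ 2 * lam * ((2 * lam) ^ p.length * (φ (Function.update (Function.update σ u 0) w 1)).re) :=
              mul_le_mul_of_nonneg_left h2 hlam0
          _ = (2 * lam) ^ (p.length + 1) * (φ (Function.update (Function.update σ u 0) w 1)).re := by
              ring
      · -- `c` empty: recurse (move the particle at `w` to `c`), then hop it to `u`
        have h1 := ih hcw σ hc hw
        set σ'' : TensorIndex Λ 2 := Function.update (Function.update σ c 0) w 1 with hσ''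
        have hσ''u : σ'' u = 1 := by
          rw [hσ'', Function.update_of_ne hub, Function.update_of_ne huc]; exact hu
        have hσ''c : σ'' c = 0 := by
          rw [hσ'', Function.update_of_ne hcw, Function.update_self]
        have h2 := re_le_two_mul_lam_mul_re_of_hop G Δ hnn hHφ hlam hadj.symm hσ''c hσ''u
        have heq : Function.update (Function.update σ'' c 1) u 0 =
            Function.update (Function.update σ u 0) w 1 := by
          have e1 : Function.update (Function.update σ c 0) w 1 =
              Function.update (Function.update σ w 1) c 0 := Function.update_comm hcw _ _ _
          have e2 : (Function.update σ w 1) c = 1 := by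
            rw [Function.update_of_ne hcw]; exact hc
          rw [hσ'', e1, Function.update_idem, update_eq_of_apply_eq e2, Function.update_comm hub]
        rw [heq] at h2
        calc (φ σ).re ≤ (2 * lam) ^ p.length * (φ σ'').re := h1
          _ ≤ (2 * lam) ^ p.length * (2 * lam * (φ (Function.update (Function.update σ u 0) w 1)).re) :=
              mul_le_mul_of_nonneg_left h2 (by positivity)
          _ = (2 * lam) ^ (p.length + 1) * (φ (Function.update (Function.update σ u 0) w 1)).re := by
              ring

end Ham

/-! ### Row sums: the all-ones vector, Collatz–Wielandt, and the hop budget per row -/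

section RowSums

variable (G : SimpleGraph Λ) [DecidableRel G.Adj] (Δ : ℝ)

/-- **`H_Heis 𝟙 = (|E(G)|/4) 𝟙` for spin ½**: every row of the Heisenberg matrix sums to `|E(G)|/4`
(the all-ones vector is the fully polarised ferromagnetic state, an eigenvector of each
`𝐒_x · 𝐒_y` with eigenvalue `¼`). Tasaki (2020) §2.4. [folklore] -/
theorem heis_mulVec_const (σ : TensorIndex Λ 2) :
    ((heisenbergHamiltonian 1 G 1 : Op Λ 2) *ᵥ fun _ => (1 : ℂ)) σ = (G.edgeFinset.card : ℂ) / 4 := by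
  rw [heisenbergHamiltonian, Matrix.smul_mulVec, Complex.ofReal_one, one_smul, Matrix.sum_mulVec,
    Finset.sum_apply]
  have hterm : ∀ e ∈ G.edgeFinset, ((spinDotSym 1 e : Op Λ 2) *ᵥ fun _ => (1 : ℂ)) σ = 1 / 4 := by
    intro e he
    induction e using Sym2.ind with
    | h x y =>
      have hxy : x ≠ y := by
        rw [SimpleGraph.mem_edgeFinset, SimpleGraph.mem_edgeSet] at he
        exact he.ne
      rw [spinDotSym_mk, spinDot_one_mulVec_const hxy]
  rw [Finset.sum_congr rfl hterm, Finset.sum_const, nsmul_eq_mul]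
  ring

/-- **Row sums of `H_G(Δ)`**: `Σ_τ Re H_{στ} = -|E(G)|/4 + (1-Δ) S(σ)`. [folklore] -/
theorem sum_re_ham_row (σ : TensorIndex Λ 2) :
    ∑ τ, ((xxzHamiltonian 1 G (-1) Δ : Op Λ 2) σ τ).re =
      -(G.edgeFinset.card : ℝ) / 4 + (1 - Δ) * (∑ e ∈ G.edgeFinset, Sym2.lift ⟨fun x y => ((1 : ℝ) / 2 - (σ x : ℕ)) * ((1 : ℝ) / 2 - (σ y : ℕ)), fun _ _ => mul_comm _ _⟩ e) := by
  have h1 : ∑ τ, ((xxzHamiltonian 1 G (-1) Δ : Op Λ 2) σ τ).re =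
      (((xxzHamiltonian 1 G (-1) Δ : Op Λ 2) *ᵥ fun _ => (1 : ℂ)) σ).re := by
    rw [mulVec, dotProduct, Complex.re_sum]
    simp only [mul_one]
  rw [h1, ham_eq_neg_heis_add_diagonal G Δ, Matrix.add_mulVec, Matrix.neg_mulVec, Pi.add_apply,
    Pi.neg_apply, heis_mulVec_const, mulVec_diagonal, mul_one, Complex.add_re, Complex.neg_re,
    Complex.ofReal_re]
  have : ((G.edgeFinset.card : ℂ) / 4).re = (G.edgeFinset.card : ℝ) / 4 := by
    rw [show (G.edgeFinset.card : ℂ) / 4 = (((G.edgeFinset.card : ℝ) / 4 : ℝ) : ℂ) by push_cast; ring,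
      Complex.ofReal_re]
  rw [this]
  ring

/-- **Diagonal entries of `H_G(Δ)`**: `Re H_{σσ} = -Δ S(σ)`. [folklore] -/
theorem re_ham_diag (σ : TensorIndex Λ 2) :
    ((xxzHamiltonian 1 G (-1) Δ : Op Λ 2) σ σ).re = -Δ * (∑ e ∈ G.edgeFinset, Sym2.lift ⟨fun x y => ((1 : ℝ) / 2 - (σ x : ℕ)) * ((1 : ℝ) / 2 - (σ y : ℕ)), fun _ _ => mul_comm _ _⟩ e) := by
  have hheis : (heisenbergHamiltonian 1 G 1 σ σ : ℂ) = (((∑ e ∈ G.edgeFinset, Sym2.lift ⟨fun x y => ((1 : ℝ) / 2 - (σ x : ℕ)) * ((1 : ℝ) / 2 - (σ y : ℕ)), fun _ _ => mul_comm _ _⟩ e) : ℝ) : ℂ) := by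
    rw [heisenbergHamiltonian_apply]
    push_cast
    rw [one_mul]
    refine Finset.sum_congr rfl fun e he => ?_
    induction e using Sym2.ind with
    | h x y =>
      have hxy : x ≠ y := by
        rw [SimpleGraph.mem_edgeFinset, SimpleGraph.mem_edgeSet] at he
        exact he.ne
      rw [spinDotSym_mk, spinDot_apply_self 1 hxy, Sym2.lift_mk]
      push_cast
      ring
  have hd : (diagonal (fun σ : TensorIndex Λ 2 => (((1 - Δ) * ∑ e ∈ G.edgeFinset,
      Sym2.lift ⟨fun x y => ((1 : ℝ) / 2 - (σ x : ℕ)) * ((1 : ℝ) / 2 - (σ y : ℕ)),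
        fun _ _ => mul_comm _ _⟩ e : ℝ) : ℂ)) : Op Λ 2) σ σ = (((1 - Δ) * (∑ e ∈ G.edgeFinset, Sym2.lift ⟨fun x y => ((1 : ℝ) / 2 - (σ x : ℕ)) * ((1 : ℝ) / 2 - (σ y : ℕ)), fun _ _ => mul_comm _ _⟩ e) : ℝ) : ℂ) := by
    rw [diagonal_apply_eq]
  rw [ham_eq_neg_heis_add_diagonal G Δ, Matrix.add_apply, Matrix.neg_apply, hd, hheis, Complex.add_re,
    Complex.neg_re, Complex.ofReal_re, Complex.ofReal_re]
  ring

/-- **The hop budget of a row**: `Σ_{τ ≠ σ} Re(-H_{στ}) = |E(G)|/4 - S(σ) ≤ |E(G)|/2`, and each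
term is `≥ 0`. [folklore] -/
theorem sum_re_neg_ham_offdiag (σ : TensorIndex Λ 2) :
    ∑ τ ∈ (Finset.univ : Finset (TensorIndex Λ 2)).erase σ, (-(xxzHamiltonian 1 G (-1) Δ : Op Λ 2) σ τ).re
      = (G.edgeFinset.card : ℝ) / 4 - (∑ e ∈ G.edgeFinset, Sym2.lift ⟨fun x y => ((1 : ℝ) / 2 - (σ x : ℕ)) * ((1 : ℝ) / 2 - (σ y : ℕ)), fun _ _ => mul_comm _ _⟩ e) := by
  have h := sum_re_ham_row G Δ σ
  rw [← Finset.add_sum_erase _ _ (Finset.mem_univ σ), re_ham_diag G Δ σ] at h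
  have : ∑ τ ∈ (Finset.univ : Finset (TensorIndex Λ 2)).erase σ, (-(xxzHamiltonian 1 G (-1) Δ : Op Λ 2) σ τ).re
      = -∑ τ ∈ (Finset.univ : Finset (TensorIndex Λ 2)).erase σ, ((xxzHamiltonian 1 G (-1) Δ : Op Λ 2) σ τ).re := by
    rw [← Finset.sum_neg_distrib]
    refine Finset.sum_congr rfl fun τ _ => ?_
    rw [Complex.neg_re]
  rw [this]
  linarith

/-- The hop budget of a row is at most `|E(G)|/2`. [folklore] -/
theorem sum_re_neg_ham_offdiag_le (σ : TensorIndex Λ 2) :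
    ∑ τ ∈ (Finset.univ : Finset (TensorIndex Λ 2)).erase σ, (-(xxzHamiltonian 1 G (-1) Δ : Op Λ 2) σ τ).re
      ≤ (G.edgeFinset.card : ℝ) / 2 := by
  rw [sum_re_neg_ham_offdiag G Δ σ]
  have := abs_isingSum_le G σ
  have := neg_abs_le ((∑ e ∈ G.edgeFinset, Sym2.lift ⟨fun x y => ((1 : ℝ) / 2 - (σ x : ℕ)) * ((1 : ℝ) / 2 - (σ y : ℕ)), fun _ _ => mul_comm _ _⟩ e))
  linarith

/-- **Collatz–Wielandt lower bound**: a nonnegative eigenvector of the stoquastic matrix `H_G(Δ)`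
has eigenvalue at least the minimal row sum, `E ≥ -|E(G)|/4 - |1-Δ|·|E(G)|/4` (evaluate the
eigen-equation at a maximal entry). [folklore] -/
theorem eigenvalue_ge_of_nonneg {φ : TensorIndex Λ 2 → ℂ} (hnn : ∀ σ, 0 ≤ (φ σ).re ∧ (φ σ).im = 0)
    (hφ0 : φ ≠ 0) {E : ℝ} (hHφ : (xxzHamiltonian 1 G (-1) Δ : Op Λ 2) *ᵥ φ = (E : ℂ) • φ) :
    -(G.edgeFinset.card : ℝ) / 4 - |1 - Δ| * (G.edgeFinset.card : ℝ) / 4 ≤ E := by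
  obtain ⟨happ, hreal, hsymm, hoff⟩ := ham_entries G Δ
  set H : Op Λ 2 := xxzHamiltonian 1 G (-1) Δ with hHdef
  haveI : Nonempty (TensorIndex Λ 2) := ⟨fun _ => 0⟩
  obtain ⟨σ, -, hmax⟩ := Finset.exists_max_image (Finset.univ : Finset (TensorIndex Λ 2))
    (fun ρ => (φ ρ).re) Finset.univ_nonempty
  have hσpos : 0 < (φ σ).re := by
    by_contra hle
    push Not at hle
    apply hφ0
    funext ρ
    have h1 := hmax ρ (Finset.mem_univ ρ)
    have h2 := (hnn ρ).1
    exact Complex.ext (by rw [Pi.zero_apply, Complex.zero_re]; linarith)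
      (by rw [(hnn ρ).2, Pi.zero_apply, Complex.zero_im])
  have him : ∀ a b, (H a b).im = 0 := fun a b => by
    have h := congrArg Complex.im (hreal a b)
    rw [Complex.star_def, Complex.conj_im] at h
    linarith
  have hrow := congrFun hHφ σ
  rw [Pi.smul_apply, smul_eq_mul, mulVec, dotProduct] at hrow
  have hrowre : ∑ ρ, (H σ ρ).re * (φ ρ).re = E * (φ σ).re := by
    have h := congrArg Complex.re hrow
    rw [Complex.re_sum, Complex.re_ofReal_mul] at h
    have hre : ∀ ρ, (H σ ρ * φ ρ).re = (H σ ρ).re * (φ ρ).re := fun ρ => by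
      rw [Complex.mul_re, him, (hnn ρ).2, mul_zero, sub_zero]
    simp_rw [hre] at h
    exact h
  -- `Σ_ρ H_σρ φ_ρ ≥ (Σ_ρ H_σρ) φ_σ`
  have hkey : (∑ ρ, (H σ ρ).re) * (φ σ).re ≤ ∑ ρ, (H σ ρ).re * (φ ρ).re := by
    rw [Finset.sum_mul]
    refine Finset.sum_le_sum fun ρ _ => ?_
    by_cases hρ : σ = ρ
    · rw [hρ]
    · -- `H_σρ ≤ 0` and `φ ρ ≤ φ σ`
      have h1 := hoff σ ρ hρ
      have h2 := hmax ρ (Finset.mem_univ ρ)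
      nlinarith
  rw [hrowre, sum_re_ham_row G Δ σ] at hkey
  have hS := abs_isingSum_le G σ
  have hS' : -(|1 - Δ| * ((G.edgeFinset.card : ℝ) / 4)) ≤ (1 - Δ) * (∑ e ∈ G.edgeFinset, Sym2.lift ⟨fun x y => ((1 : ℝ) / 2 - (σ x : ℕ)) * ((1 : ℝ) / 2 - (σ y : ℕ)), fun _ _ => mul_comm _ _⟩ e) := by
    have h1 : |(1 - Δ) * (∑ e ∈ G.edgeFinset, Sym2.lift ⟨fun x y => ((1 : ℝ) / 2 - (σ x : ℕ)) * ((1 : ℝ) / 2 - (σ y : ℕ)), fun _ _ => mul_comm _ _⟩ e)| ≤ |1 - Δ| * ((G.edgeFinset.card : ℝ) / 4) := by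
      rw [abs_mul]; exact mul_le_mul_of_nonneg_left hS (abs_nonneg _)
    have := neg_abs_le ((1 - Δ) * (∑ e ∈ G.edgeFinset, Sym2.lift ⟨fun x y => ((1 : ℝ) / 2 - (σ x : ℕ)) * ((1 : ℝ) / 2 - (σ y : ℕ)), fun _ _ => mul_comm _ _⟩ e))
    linarith
  have h3 : (-(G.edgeFinset.card : ℝ) / 4 - |1 - Δ| * (G.edgeFinset.card : ℝ) / 4) * (φ σ).re ≤
      E * (φ σ).re := by
    refine le_trans (mul_le_mul_of_nonneg_right ?_ hσpos.le) hkey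
    linarith
  exact le_of_mul_le_mul_right h3 hσpos

/-- **The per-row constant `λ`**: for `|Δ| ≤ 1`, `Re H_{ττ} - E ≤ |E(G)|` along any nonnegative
eigenvector. [folklore] -/
theorem re_diag_sub_eigenvalue_le {φ : TensorIndex Λ 2 → ℂ} (hnn : ∀ σ, 0 ≤ (φ σ).re ∧ (φ σ).im = 0)
    (hφ0 : φ ≠ 0) {E : ℝ} (hHφ : (xxzHamiltonian 1 G (-1) Δ : Op Λ 2) *ᵥ φ = (E : ℂ) • φ)
    (hΔ : |Δ| ≤ 1) (τ : TensorIndex Λ 2) :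
    ((xxzHamiltonian 1 G (-1) Δ : Op Λ 2) τ τ).re - E ≤ (G.edgeFinset.card : ℝ) := by
  have hE := eigenvalue_ge_of_nonneg G Δ hnn hφ0 hHφ
  have hd : |((xxzHamiltonian 1 G (-1) Δ : Op Λ 2) τ τ).re| ≤ |Δ| * (G.edgeFinset.card : ℝ) / 4 :=
    abs_re_ham_diag_le G Δ τ
  have h1 := le_abs_self (((xxzHamiltonian 1 G (-1) Δ : Op Λ 2) τ τ).re)
  have hB : 0 ≤ (G.edgeFinset.card : ℝ) := Nat.cast_nonneg _
  have h1Δ : |1 - Δ| ≤ 2 := by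
    have := abs_sub_abs_le_abs_sub 1 Δ
    rw [abs_one] at this
    have h' : |1 - Δ| ≤ |1| + |Δ| := abs_sub 1 Δ
    rw [abs_one] at h'
    linarith
  nlinarith [mul_le_mul_of_nonneg_right hΔ hB, mul_le_mul_of_nonneg_right h1Δ hB]

/-- **Registered form (torus)** of `heis_mulVec_const`: on the `M × M` torus every row of the
spin-½ Heisenberg matrix sums to `|E|/4`. [folklore] -/
theorem crudeFloor_heis_rowsum_torus :
    ∀ (M : ℕ) [NeZero M] (σ : TensorIndex (TorusSite 2 M) 2),
      ((heisenbergHamiltonian 1 (torusGraph 2 M) 1 : Op (TorusSite 2 M) 2) *ᵥ fun _ => (1 : ℂ)) σ =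
        ((torusGraph 2 M).edgeFinset.card : ℂ) / 4 :=
  fun M _ σ => heis_mulVec_const (torusGraph 2 M) σ

end RowSums

end CrudeFloor

end Summit.HubbardSuperconductivity.HubbardSuperconductivity.Theorems.LevyLogBootstrap

end
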